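import Literature.Barriers.NavierStokesRegularity.CriticalDataSmoothNonuniquenessConstruction
import Literature.Analysis.FluidPDE.LinearizedOseenLayers
import Literature.Analysis.FluidPDE.ForcedOseenMildPeriodic
import Literature.Analysis.FluidPDE.ClassicalSolutionTorusProofs
import Literature.Analysis.FunctionSpaces.TorusSupNormContinuity
import HarnessLib

/-!
# Coiculescu–Palasek 2025: an approximate solution as input of the forcing-form perturbation
  scheme (envelopes, forcing pairs, Duhamel formula of the principal part)

Fourth sibling of the proof files of the barrier entry
`Literature/Barriers/NavierStokesRegularity/CriticalDataSmoothNonuniqueness` (D-0021; M. P.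
Coiculescu, S. Palasek, *Non-uniqueness of smooth solutions of the Navier–Stokes equations from
critical data*, Invent. Math. 244 (2025), arXiv:2503.14699). The corrected perturbation step
(hypothesis `hB` of `CriticalDataSmoothNonuniqueness_of_principalParts_of_perturbationThreshold`,
Props. 4.2–4.3 without the Hölder slot) is proved in the tree on the whole space, in forcing form
and with sup norms only (`Literature.Analysis.FluidPDE.nlLimit_spec`: files `LinearizedOseenWindow`,
`LinearizedOseenLayers`, `LinearizedOseenDyadicLimit`, `LacunaryOseenNonlinearCorrection`), from two
abstract inputs: a lacunary coefficient `LacunaryCoeff T K₀ C η ṽ V` ((3.13a) `m = 0`, (3.13b))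
and forcing pairs `ForcingPairs T α N a b A B` (`‖F‖_Y ≤ ε₀`, sup slot). This file reads these
inputs off an approximate solution `(v, F, π)` in the sense of
`CoiculescuPalasek2025.IsApproximateSolution` (Prop. 3.13, eq. (4.1), Prop. 4.1), for the lifted
fields truncated to `(0, T_*]`:

* `ṽ(τ) = 𝟙_{(0,T_*]}(τ) lift v(τ)` with envelope `V(τ) = ‖v(τ)‖_{L^∞}`
  (`IsApproximateSolution.lacunaryCoeff`: (3.13a), (3.13b), continuity of the envelope by
  `Torus.IsSmoothSpaceTimeOn.continuousOn_toReal_eSupNorm`);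
* the nine rank-one pairs `(eⱼ, F̃ᵢⱼ eᵢ)`, `F̃ᵢⱼ(τ) = 𝟙_{(0,T_*]}(τ) lift Fᵢⱼ(τ)`, with envelopes
  `1`, `ε₀ τ^{α-1}` (`IsApproximateSolution.forcingPairs`: Prop. 4.1, `‖F‖_Y ≤ ε₀`);
* the Duhamel formula of the principal part from every base time,
  `ṽ(t) = e^{(t-s)Δ}ṽ(s) - B_s(ṽ,ṽ)(t) - Σ_{(i,j)} B_s(eⱼ, F̃ᵢⱼeᵢ)(t)` (eq. (4.1) in mild form,
  `IsApproximateSolution.trunc_eq_forced_oseenMild`, from `Torus.lift_eq_forced_oseenMild`);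
* periodicity, divergence-freeness and torus representatives of the slices.

## References

* M. P. Coiculescu, S. Palasek, Invent. Math. 244 (2025), 165–219 = arXiv:2503.14699: Prop. 3.13
  ((3.13a), (3.13b)), §4.1 eq. (4.1), Prop. 4.1, §4.2 (spaces `X`, `Y`), proof of Prop. 4.3
  (Duhamel formula). [`CoiculescuPalasek2025`]
-/

noncomputable section

open MeasureTheory Set Filter Function UnitAddTorus
open _root_.Topology
open scoped InnerProductSpace RealInnerProductSpace ENNReal NNReal

namespace Literature.Barriers.NavierStokesRegularity

open Literature.Analysis.FunctionSpaces Literature.Analysis.FluidPDE CoiculescuPalasek2025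

/-- Local notation for physical space `ℝ³ = EuclideanSpace ℝ (Fin 3)`. -/
local notation "ℝ³" => EuclideanSpace ℝ (Fin 3)
/-- Local notation for the flat torus `𝕋³ = (ℝ/ℤ)³`. -/
local notation "𝕋³" => UnitAddTorus (Fin 3)

namespace CoiculescuPalasek2025

variable {α : ℝ} {κ : ℝ≥0} {K : ℕ → ℝ} {C η ε₀ : ℝ}
  {v : ℝ → 𝕋³ → ℝ³} {F : ℝ → 𝕋³ → (Fin 3 → Fin 3 → ℝ)} {π : ℝ → 𝕋³ → ℝ}

/-! ### Scalars read off an approximate solution -/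

/-- The lacunarity constant of an approximate solution is non-negative ((3.13b) with `t₁ = t₂`).
[cite: CoiculescuPalasek2025, Prop. 3.13 (3.13b)] -/
theorem IsApproximateSolution.C_nonneg (h : IsApproximateSolution unitTime α κ K C η ε₀ v F π) :
    0 ≤ C := by
  have h1 := h.lacunary_le unitTime unitTime unitTime_pos le_rfl le_rfl
  simpa [div_self unitTime_pos.ne'] using h1

/-- Pointwise values are bounded by the sup norm of the slice. [folklore] -/
theorem IsApproximateSolution.norm_le_toReal_eSupNorm
    (h : IsApproximateSolution unitTime α κ K C η ε₀ v F π) {t : ℝ} (ht : t ∈ Ioc 0 unitTime)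
    (x : 𝕋³) : ‖v t x‖ ≤ (eSupNorm (v t)).toReal :=
  Torus.norm_le_toReal_eSupNorm (h.continuous_slice ht) x

/-- **(3.13a), `m = 0`, for the sup norm**: `√t ‖v(t)‖_{L^∞} ≤ |K₀|`. [cite: CoiculescuPalasek2025, Prop. 3.13 (3.13a)] -/
theorem IsApproximateSolution.sqrt_mul_toReal_eSupNorm_le
    (h : IsApproximateSolution unitTime α κ K C η ε₀ v F π) {t : ℝ} (ht : t ∈ Ioc 0 unitTime) :
    Real.sqrt t * (eSupNorm (v t)).toReal ≤ |K 0| := by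
  have hst : 0 < Real.sqrt t := Real.sqrt_pos.2 ht.1
  have hb : ∀ x, ‖v t x‖ ≤ |K 0| / Real.sqrt t := fun x => by
    rw [le_div_iff₀ hst, mul_comm]; exact h.sqrt_mul_norm_le ht x
  have h1 : eSupNorm (v t) ≤ ENNReal.ofReal (|K 0| / Real.sqrt t) := by
    refine iSup_le fun x => ?_
    rw [← ofReal_norm]
    exact ENNReal.ofReal_le_ofReal (hb x)
  have h2 : (eSupNorm (v t)).toReal ≤ |K 0| / Real.sqrt t := by
    have := ENNReal.toReal_mono ENNReal.ofReal_ne_top h1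
    rwa [ENNReal.toReal_ofReal (div_nonneg (abs_nonneg _) hst.le)] at this
  calc Real.sqrt t * (eSupNorm (v t)).toReal ≤ Real.sqrt t * (|K 0| / Real.sqrt t) := by gcongr
    _ = |K 0| := mul_div_cancel₀ _ hst.ne'

/-- **The residual bound in sup form** (Prop. 4.1, `‖F‖_Y ≤ ε₀`): `|Fᵢⱼ(t, x)| ≤ ε₀ t^{α-1}` on
`(0, T_*]`. [cite: CoiculescuPalasek2025, Prop. 4.1 and §4.2 (space Y)] -/
theorem IsApproximateSolution.abs_residual_le
    (h : IsApproximateSolution unitTime α κ K C η ε₀ v F π) (hε₀ : 0 ≤ ε₀) {t : ℝ}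
    (ht : t ∈ Ioc 0 unitTime) (x : 𝕋³) (i j : Fin 3) : |F t x i j| ≤ ε₀ * t ^ (α - 1) := by
  have ha : 0 < t ^ (1 - α) := Real.rpow_pos_of_pos ht.1 _
  have h1 : ENNReal.ofReal (t ^ (1 - α)) * eSupNorm (F t) ≤ ENNReal.ofReal ε₀ :=
    le_trans le_self_add (h.residual_le t ht)
  have h2 : eSupNorm (F t) ≤ ENNReal.ofReal (ε₀ / t ^ (1 - α)) := by
    rw [ENNReal.ofReal_div_of_pos ha]
    refine (ENNReal.le_div_iff_mul_le (Or.inl ((ENNReal.ofReal_pos.2 ha).ne'))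
      (Or.inl ENNReal.ofReal_ne_top)).2 ?_
    rwa [mul_comm]
  have h3 : ‖F t x‖ ≤ ε₀ / t ^ (1 - α) := by
    have h4 : ‖F t x‖ₑ ≤ ENNReal.ofReal (ε₀ / t ^ (1 - α)) := (enorm_le_eSupNorm _ x).trans h2
    rw [← ofReal_norm] at h4
    exact (ENNReal.ofReal_le_ofReal_iff (div_nonneg hε₀ ha.le)).1 h4
  have h5 : ε₀ / t ^ (1 - α) = ε₀ * t ^ (α - 1) := by
    rw [div_eq_mul_inv, ← Real.rpow_neg ht.1.le, neg_sub]
  calc |F t x i j| = ‖F t x i j‖ := (Real.norm_eq_abs _).symm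
    _ ≤ ‖F t x i‖ := norm_le_pi_norm _ j
    _ ≤ ‖F t x‖ := norm_le_pi_norm _ i
    _ ≤ ε₀ * t ^ (α - 1) := h5 ▸ h3

/-! ### The lacunary coefficient -/

/-- Joint continuity of the lifted velocity on `(0, T_*] × ℝ³`. [folklore] -/
theorem IsApproximateSolution.continuousOn_uncurry_lift
    (h : IsApproximateSolution unitTime α κ K C η ε₀ v F π) :
    ContinuousOn (uncurry fun τ => Torus.lift (v τ)) (Ioc 0 unitTime ×ˢ univ) :=
  (IsClassicalNSSolutionOn.of_torus_holds h.solution).smooth_velocity.continuousOn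

/-- Joint measurability of the truncated lifted velocity. [folklore] -/
theorem IsApproximateSolution.measurable_truncLift
    (h : IsApproximateSolution unitTime α κ K C η ε₀ v F π) :
    Measurable (uncurry fun (τ : ℝ) (y : ℝ³) =>
      if τ ∈ Ioc 0 unitTime then Torus.lift (v τ) y else 0) := by
  have heq : (uncurry fun (τ : ℝ) (y : ℝ³) => if τ ∈ Ioc 0 unitTime then Torus.lift (v τ) y else 0) =
      (Ioc 0 unitTime ×ˢ (univ : Set ℝ³)).piecewise (uncurry fun τ => Torus.lift (v τ)) 0 := by
    funext q
    by_cases hq : q.1 ∈ Ioc 0 unitTime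
    · rw [Set.piecewise_eq_of_mem _ _ _ (mk_mem_prod hq (mem_univ q.2))]; exact if_pos hq
    · rw [Set.piecewise_eq_of_notMem _ _ _ (fun hm => hq (mem_prod.1 hm).1)]; exact if_neg hq
  rw [heq]
  exact h.continuousOn_uncurry_lift.measurable_piecewise continuousOn_const
    (measurableSet_Ioc.prod MeasurableSet.univ)

/-- **An approximate solution is a lacunary coefficient**: with `ṽ(τ) = 𝟙_{(0,T_*]}(τ) lift v(τ)` and
`V(τ) = ‖v(τ)‖_{L^∞}`, the data `(T_*, |K₀|, C, η)` satisfy `LacunaryCoeff` ((3.13a) with `m = 0`,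
(3.13b) verbatim, continuity of the envelope on `(0, T_*]`). [cite: CoiculescuPalasek2025, Prop. 3.13 ((3.13a), (3.13b))] -/
theorem IsApproximateSolution.lacunaryCoeff (h : IsApproximateSolution unitTime α κ K C η ε₀ v F π)
    (hη : 0 ≤ η) :
    LacunaryCoeff unitTime |K 0| C η
      (fun (τ : ℝ) (y : ℝ³) => if τ ∈ Ioc 0 unitTime then Torus.lift (v τ) y else 0)
      (fun τ => (eSupNorm (v τ)).toReal) where
  meas := h.measurable_truncLift
  bound τ hτ y := by
    simp only [if_pos hτ, Torus.lift_apply]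
    exact h.norm_le_toReal_eSupNorm hτ _
  cont := h.solution.smooth_velocity.continuousOn_toReal_eSupNorm
  nonneg τ _ := ENNReal.toReal_nonneg
  K₀_nonneg := abs_nonneg _
  C_nonneg := h.C_nonneg
  η_nonneg := hη
  kato τ hτ := h.sqrt_mul_toReal_eSupNorm_le hτ
  lacunary := h.lacunary_le

/-! ### The forcing pairs -/

/-- Joint continuity of the lifted entries of the residual on `(0, T_*] × ℝ³`. [folklore] -/
theorem IsApproximateSolution.continuousOn_residual_entry
    (h : IsApproximateSolution unitTime α κ K C η ε₀ v F π) (i j : Fin 3) :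
    ContinuousOn (fun q : ℝ × ℝ³ => F q.1 (Torus.proj q.2) i j) (Ioc 0 unitTime ×ˢ univ) := by
  have h1 : Torus.IsSmoothSpaceTimeOn (Ioc 0 unitTime) (fun t x => F t x i j) :=
    ((ContinuousLinearMap.proj (R := ℝ) (φ := fun _ : Fin 3 => ℝ) j).comp
      (ContinuousLinearMap.proj (R := ℝ) (φ := fun _ : Fin 3 => Fin 3 → ℝ) i)).contDiff.comp_contDiffOn
      h.smooth_residual
  exact h1.continuousOn_stLift

/-- **An approximate solution yields forcing pairs**: the nine rank-one pairs `(eⱼ, F̃ᵢⱼ eᵢ)`,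
`F̃ᵢⱼ(τ) = 𝟙_{(0,T_*]}(τ) lift Fᵢⱼ(τ)`, with envelopes `1` and `ε₀ τ^{α-1}`, `N = 9ε₀`
(Prop. 4.1: `t^{1-α}‖F(t)‖_{L^∞} ≤ ε₀`). [cite: CoiculescuPalasek2025, Prop. 4.1 and §4.2 (space Y)] -/
theorem IsApproximateSolution.forcingPairs (h : IsApproximateSolution unitTime α κ K C η ε₀ v F π)
    (hα : 0 < α) (hα1 : α ≤ 1) (hε₀ : 0 ≤ ε₀) :
    ForcingPairs unitTime α (9 * ε₀)
      (fun (p : Fin 3 × Fin 3) (_ : ℝ) (_ : ℝ³) => EuclideanSpace.single p.2 (1 : ℝ))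
      (fun (p : Fin 3 × Fin 3) (τ : ℝ) (y : ℝ³) =>
        if τ ∈ Ioc 0 unitTime then F τ (Torus.proj y) p.1 p.2 • EuclideanSpace.single p.1 (1 : ℝ) else 0)
      (fun _ _ => 1) (fun _ τ => ε₀ * τ ^ (α - 1)) where
  T_pos := unitTime_pos
  α_pos := hα
  α_le := hα1
  N_nonneg := by positivity
  meas_a _ := measurable_const
  meas_b p := by
    have heq : (uncurry fun (τ : ℝ) (y : ℝ³) =>
        if τ ∈ Ioc 0 unitTime then F τ (Torus.proj y) p.1 p.2 • EuclideanSpace.single p.1 (1 : ℝ) else 0) =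
        (Ioc 0 unitTime ×ˢ (univ : Set ℝ³)).piecewise
          (fun q => F q.1 (Torus.proj q.2) p.1 p.2 • EuclideanSpace.single p.1 (1 : ℝ)) 0 := by
      funext q
      by_cases hq : q.1 ∈ Ioc 0 unitTime
      · rw [Set.piecewise_eq_of_mem _ _ _ (mk_mem_prod hq (mem_univ q.2))]; exact if_pos hq
      · rw [Set.piecewise_eq_of_notMem _ _ _ (fun hm => hq (mem_prod.1 hm).1)]; exact if_neg hq
    rw [heq]
    exact ((h.continuousOn_residual_entry p.1 p.2).smul continuousOn_const).measurable_piecewise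
      continuousOn_const (measurableSet_Ioc.prod MeasurableSet.univ)
  bound_a p τ _ y := by simp [PiLp.norm_single]
  bound_b p τ hτ y := by
    simp only [if_pos hτ, norm_smul, PiLp.norm_single, norm_one, mul_one, Real.norm_eq_abs]
    exact h.abs_residual_le hε₀ hτ _ _ _
  cont_A _ := continuousOn_const
  cont_B _ := continuousOn_const.mul
    (ContinuousOn.rpow_const continuousOn_id fun τ hτ => Or.inl hτ.1.ne')
  A_nonneg _ _ _ := zero_le_one
  B_nonneg _ τ hτ := mul_nonneg hε₀ (Real.rpow_nonneg hτ.1.le _)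
  dom τ hτ := by
    simp only [one_mul, Finset.sum_const, Finset.card_univ, Fintype.card_prod, Fintype.card_fin,
      nsmul_eq_mul]
    norm_num
    rw [mul_assoc]

/-! ### Periodicity, representatives, divergence -/

/-- Lattice translations do not move `proj`. [folklore] -/
theorem proj_add_single (y : ℝ³) (j : Fin 3) :
    Torus.proj (y + EuclideanSpace.single j (1 : ℝ)) = Torus.proj y := by
  rw [Torus.proj_add, ← Torus.latticeVec_single, Torus.proj_latticeVec, add_zero]

/-- The truncated lifted velocity is lattice periodic at every time. [folklore] -/
theorem IsApproximateSolution.truncLift_periodic (v : ℝ → 𝕋³ → ℝ³) (τ : ℝ) (j : Fin 3) (y : ℝ³) :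
    (fun (τ : ℝ) (y : ℝ³) => if τ ∈ Ioc 0 unitTime then Torus.lift (v τ) y else 0) τ
        (y + EuclideanSpace.single j (1 : ℝ)) =
      (fun (τ : ℝ) (y : ℝ³) => if τ ∈ Ioc 0 unitTime then Torus.lift (v τ) y else 0) τ y := by
  by_cases hτ : τ ∈ Ioc 0 unitTime
  · simp only [if_pos hτ, Torus.lift_apply, proj_add_single]
  · simp only [if_neg hτ]

/-- The truncated forcing fields are lattice periodic at every time. [folklore] -/
theorem IsApproximateSolution.truncForce_periodic (F : ℝ → 𝕋³ → (Fin 3 → Fin 3 → ℝ))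
    (p : Fin 3 × Fin 3) (τ : ℝ) (j : Fin 3) (y : ℝ³) :
    (fun (τ : ℝ) (y : ℝ³) =>
        if τ ∈ Ioc 0 unitTime then F τ (Torus.proj y) p.1 p.2 • EuclideanSpace.single p.1 (1 : ℝ) else 0) τ
        (y + EuclideanSpace.single j (1 : ℝ)) =
      (fun (τ : ℝ) (y : ℝ³) =>
        if τ ∈ Ioc 0 unitTime then F τ (Torus.proj y) p.1 p.2 • EuclideanSpace.single p.1 (1 : ℝ) else 0) τ y := by
  by_cases hτ : τ ∈ Ioc 0 unitTime
  · simp only [if_pos hτ, proj_add_single]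
  · simp only [if_neg hτ]

/-- On `(0, T_*]` the truncated lift is the lift. [folklore] -/
theorem IsApproximateSolution.lift_eq_truncLift (v : ℝ → 𝕋³ → ℝ³) {τ : ℝ} (hτ : τ ∈ Ioc 0 unitTime) :
    Torus.lift (v τ) =
      (fun (τ : ℝ) (y : ℝ³) => if τ ∈ Ioc 0 unitTime then Torus.lift (v τ) y else 0) τ :=
  funext fun y => by simp only [if_pos hτ]

/-- On `(0, T_*]` the truncated forcing field is the lift of a continuous torus field. [folklore] -/
theorem IsApproximateSolution.lift_eq_truncForce (F : ℝ → 𝕋³ → (Fin 3 → Fin 3 → ℝ))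
    (p : Fin 3 × Fin 3) {τ : ℝ} (hτ : τ ∈ Ioc 0 unitTime) :
    Torus.lift (fun x : 𝕋³ => F τ x p.1 p.2 • EuclideanSpace.single p.1 (1 : ℝ)) =
      (fun (τ : ℝ) (y : ℝ³) =>
        if τ ∈ Ioc 0 unitTime then F τ (Torus.proj y) p.1 p.2 • EuclideanSpace.single p.1 (1 : ℝ) else 0) τ :=
  funext fun y => by simp only [if_pos hτ, Torus.lift_apply]

/-- The torus representatives of the forcing fields are continuous. [folklore] -/
theorem IsApproximateSolution.continuous_force_repr (h : IsApproximateSolution unitTime α κ K C η ε₀ v F π)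
    (p : Fin 3 × Fin 3) {τ : ℝ} (hτ : τ ∈ Ioc 0 unitTime) :
    Continuous fun x : 𝕋³ => F τ x p.1 p.2 • EuclideanSpace.single p.1 (1 : ℝ) := by
  have h1 : Torus.IsSmoothSpaceTimeOn (Ioc 0 unitTime) (fun t x => F t x p.1 p.2) :=
    ((ContinuousLinearMap.proj (R := ℝ) (φ := fun _ : Fin 3 => ℝ) p.2).comp
      (ContinuousLinearMap.proj (R := ℝ) (φ := fun _ : Fin 3 => Fin 3 → ℝ) p.1)).contDiff.comp_contDiffOn
      h.smooth_residual
  exact (h1.isSmooth_slice hτ).continuous.smul continuous_const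

/-- The lifted velocity slices are divergence free (classically and weakly). [cite: CoiculescuPalasek2025, Prop. 3.13 (div v = 0)] -/
theorem IsApproximateSolution.isWeaklyDivFree_truncLift (h : IsApproximateSolution unitTime α κ K C η ε₀ v F π)
    {s : ℝ} (hs : s ∈ Ioc 0 unitTime) :
    IsWeaklyDivFree
      ((fun (τ : ℝ) (y : ℝ³) => if τ ∈ Ioc 0 unitTime then Torus.lift (v τ) y else 0) s) := by
  rw [← IsApproximateSolution.lift_eq_truncLift v hs]
  have hE := IsClassicalNSSolutionOn.of_torus_holds h.solution
  exact VectorCalculus.IsDivFree.isWeaklyDivFree_holds (hE.divFree s hs)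
    ((h.solution.smooth_velocity.isSmooth_slice hs).of_le (by exact_mod_cast le_top))

/-! ### The Duhamel formula of the principal part -/

/-- **The Duhamel formula of the principal part, forcing form** (eq. (4.1) in mild form, from
every base time `s ∈ (0, T_*)`): for `0 < s < t ≤ T_*` and every `y`,
`ṽ(t)(y) = e^{(t-s)Δ}ṽ(s)(y) - B_s(ṽ,ṽ)(t)(y) - Σ_{(i,j)} B_s(eⱼ, F̃ᵢⱼeᵢ)(t)(y)` for the truncated
lifts (`Torus.lift_eq_forced_oseenMild` with the zero means of Def. 3.10/Rmk. 3.11, and the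
fields agree with the untruncated lifts on `(s, t)`). [cite: CoiculescuPalasek2025, §4.1 eq. (4.1) and proof of Prop. 4.3 (Duhamel formula)] -/
theorem IsApproximateSolution.truncLift_eq_forced_oseenMild
    (h : IsApproximateSolution unitTime α κ K C η ε₀ v F π) {s t : ℝ} (hs : 0 < s) (hst : s < t)
    (ht : t ≤ unitTime) (y : ℝ³) :
    (fun (τ : ℝ) (y : ℝ³) => if τ ∈ Ioc 0 unitTime then Torus.lift (v τ) y else 0) t y =
      Literature.Analysis.UnboundedOperators.heatExtension
          ((fun (τ : ℝ) (y : ℝ³) => if τ ∈ Ioc 0 unitTime then Torus.lift (v τ) y else 0) s) (t - s) y -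
        oseenDuhamel 1 s
          (fun (τ : ℝ) (y : ℝ³) => if τ ∈ Ioc 0 unitTime then Torus.lift (v τ) y else 0)
          (fun (τ : ℝ) (y : ℝ³) => if τ ∈ Ioc 0 unitTime then Torus.lift (v τ) y else 0) t y -
        freeFrom (fun (p : Fin 3 × Fin 3) (_ : ℝ) (_ : ℝ³) => EuclideanSpace.single p.2 (1 : ℝ))
          (fun (p : Fin 3 × Fin 3) (τ : ℝ) (y : ℝ³) =>
            if τ ∈ Ioc 0 unitTime then F τ (Torus.proj y) p.1 p.2 • EuclideanSpace.single p.1 (1 : ℝ) else 0)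
          s t y := by
  have hsI : s ∈ Ioc 0 unitTime := ⟨hs, hst.le.trans ht⟩
  have htI : t ∈ Ioc 0 unitTime := ⟨hs.trans hst, ht⟩
  have hS : Icc s t ⊆ Ioc 0 unitTime := fun τ hτ => ⟨hs.trans_le hτ.1, hτ.2.trans ht⟩
  have hmean : ∫ x, v t x = ∫ x, v s x := by
    rw [show (∫ x, v t x) = 0 from h.hasZeroMean t htI, show (∫ x, v s x) = 0 from h.hasZeroMean s hsI]
  have hmain := Torus.lift_eq_forced_oseenMild h.solution h.smooth_residual (uniqueDiffOn_Ioc 0 unitTime)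
    hst hS hmean y
  have hIoo : ∀ τ ∈ Ioo s t, τ ∈ Ioc 0 unitTime := fun τ hτ => ⟨hs.trans hτ.1, hτ.2.le.trans ht⟩
  simp only [if_pos htI]
  rw [hmain]
  have hheat : (fun y : ℝ³ => if s ∈ Ioc 0 unitTime then Torus.lift (v s) y else 0) = Torus.lift (v s) := by
    funext z; simp only [if_pos hsI]
  rw [hheat]
  congr 1
  · congr 1
    exact oseenDuhamel_congr_of_eqOn_Ioo
      (fun τ hτ => funext fun z => by simp only [if_pos (hIoo τ hτ)])
      (fun τ hτ => funext fun z => by simp only [if_pos (hIoo τ hτ)]) y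
  · unfold freeFrom
    refine Finset.sum_congr rfl fun p _ => ?_
    exact oseenDuhamel_congr_of_eqOn_Ioo (fun τ _ => rfl)
      (fun τ hτ => funext fun z => by simp only [if_pos (hIoo τ hτ)]) y

end CoiculescuPalasek2025

end Literature.Barriers.NavierStokesRegularity
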